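import Mathlib.Algebra.Group.Pointwise.Set.Basic
import Summits.PneNP.PneNP.Theorems.ReslinSizeFromWidthQuadraticFlats

/-!
# PneNP / ReslinSizeFromWidth — quadratic size–width law, part 1c: cylinders

Helper file for the quadratic truncation of crux `ResLinSizeFromWidth` (stmt-PneNP-18932).
The CYLINDER `cyl v S = S ∪ (v + S)` over a flat in a direction `v`: it is a flat, its equations are
the equations of `S` killing `v`, and if some equation of `S` sees `v` then `dim W` drops by exactly
one.  Cylinders are the "query-free lift" of the restriction lemma for width: a refutation living
inside one half `A ∩ hyp θ` of an ambient flat `A` is lifted to `A` at no cost in relative rank.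
-/

namespace Summit.PneNP.PneNP.Theorems

-- `Summit.PneNP.PneNP` repeats a path component by design (summit = sub-problem); silence the linter.
set_option linter.dupNamespace false

namespace ResLinSW
-- BEGIN BODY

open Module Submodule
open scoped Pointwise

variable {V : Type*} [Fintype V]

/-- The evaluation of (the linear part of) an equation at a vector, as a linear map on `Eqn V`. -/
def evalAt (v : V → ZMod 2) : Eqn V →ₗ[ZMod 2] ZMod 2 where
  toFun θ := θ.1 ⬝ᵥ v
  map_add' θ η := by simp [add_dotProduct]
  map_smul' c θ := by simp [smul_dotProduct]

/-- Unfolding `evalAt`. -/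
@[simp] theorem evalAt_apply (v : V → ZMod 2) (θ : Eqn V) : evalAt v θ = θ.1 ⬝ᵥ v := rfl

/-- The CYLINDER `S ∪ (v +ᵥ S)` over a set in direction `v`. -/
def cyl (v : V → ZMod 2) (S : Set (V → ZMod 2)) : Set (V → ZMod 2) := S ∪ (v +ᵥ S)

omit [Fintype V] in
/-- Membership in a cylinder. -/
theorem mem_cyl_iff {v : V → ZMod 2} {S : Set (V → ZMod 2)} {z : V → ZMod 2} :
    z ∈ cyl v S ↔ z ∈ S ∨ z + v ∈ S := by
  rw [cyl, Set.mem_union, Set.mem_vadd_set]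
  have key : ∀ w : V → ZMod 2, v +ᵥ w = z ↔ w = z + v := by
    intro w
    rw [vadd_eq_add]
    constructor
    · rintro rfl
      rw [add_comm v w, add_assoc, add_self_eq_zero, add_zero]
    · rintro rfl
      rw [add_comm z v, ← add_assoc, add_self_eq_zero, zero_add]
  constructor
  · rintro (h | ⟨w, hw, hwz⟩)
    · exact Or.inl h
    · rw [(key w).1 hwz] at hw
      exact Or.inr hw
  · rintro (h | h)
    · exact Or.inl h
    · exact Or.inr ⟨z + v, h, (key _).2 rfl⟩

omit [Fintype V] in
/-- `S ⊆ cyl v S`. -/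
theorem subset_cyl (v : V → ZMod 2) (S : Set (V → ZMod 2)) : S ⊆ cyl v S :=
  Set.subset_union_left

omit [Fintype V] in
/-- `cyl` is monotone in the set. -/
theorem cyl_mono (v : V → ZMod 2) {S T : Set (V → ZMod 2)} (h : S ⊆ T) : cyl v S ⊆ cyl v T := by
  intro z hz
  rw [mem_cyl_iff] at hz ⊢
  rcases hz with hz | hz
  · exact Or.inl (h hz)
  · exact Or.inr (h hz)

/-- The equations of a cylinder over a NONEMPTY set: those equations of `S` whose linear part
kills `v`. -/
theorem W_cyl (v : V → ZMod 2) {S : Set (V → ZMod 2)} (hne : S.Nonempty) :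
    W (cyl v S) = W S ⊓ LinearMap.ker (evalAt v) := by
  ext θ
  simp only [Submodule.mem_inf, LinearMap.mem_ker, evalAt_apply]
  constructor
  · intro h
    have hS : θ ∈ W S := W_anti (subset_cyl v S) h
    refine ⟨hS, ?_⟩
    obtain ⟨z, hz⟩ := hne
    have h1 := hS z hz
    have h2 : θ.1 ⬝ᵥ (z + v) = θ.2 := by
      refine h (z + v) (mem_cyl_iff.2 (Or.inr ?_))
      rwa [add_assoc, add_self_eq_zero, add_zero]
    rw [dotProduct_add, h1] at h2
    simpa using h2
  · rintro ⟨hS, hv⟩ z hz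
    rcases mem_cyl_iff.1 hz with h | h
    · exact hS z h
    · have := hS (z + v) h
      rwa [dotProduct_add, hv, add_zero] at this

/-- A cylinder over a flat is a flat. -/
theorem isFlat_cyl (v : V → ZMod 2) {S : Set (V → ZMod 2)} (hS : IsFlat S) : IsFlat (cyl v S) := by
  have zmod2_eq_zero_or_one : ∀ a : ZMod 2, a = 0 ∨ a = 1 := by decide
  by_cases hne : S.Nonempty
  · refine ⟨fun z hz => ?_⟩
    rw [mem_cyl_iff]
    by_contra hcon
    push Not at hcon
    obtain ⟨h1, h2⟩ := hcon
    -- equations of S violated at z and at z + v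
    have e1 : ∃ θ ∈ W S, z ∉ hyp θ := by
      by_contra h; push Not at h; exact h1 (hS.mem_of z h)
    have e2 : ∃ θ ∈ W S, z + v ∉ hyp θ := by
      by_contra h; push Not at h; exact h2 (hS.mem_of (z + v) h)
    obtain ⟨θ, hθ, hzθ⟩ := e1
    obtain ⟨η, hη, hzη⟩ := e2
    rw [mem_hyp] at hzθ hzη
    replace hzθ := zmod2_ne_iff.1 hzθ
    replace hzη := zmod2_ne_iff.1 hzη
    have hW := W_cyl v hne
    -- find an equation of the cylinder violated at z
    have viol : ∀ ξ ∈ W S, ξ.1 ⬝ᵥ v = 0 → ξ.1 ⬝ᵥ z = ξ.2 := by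
      intro ξ hξ hv
      have hξ' : ξ ∈ W (cyl v S) := by rw [hW]; exact ⟨hξ, hv⟩
      exact hz ξ hξ'
    rcases zmod2_eq_zero_or_one (θ.1 ⬝ᵥ v) with hθv | hθv
    · have := viol θ hθ hθv
      rw [this] at hzθ
      exact absurd hzθ (by rcases zmod2_eq_zero_or_one θ.2 with h | h <;> rw [h] <;> decide)
    rcases zmod2_eq_zero_or_one (η.1 ⬝ᵥ v) with hηv | hηv
    · have := viol η hη hηv
      rw [dotProduct_add, hηv, add_zero] at hzη
      rw [this] at hzη
      exact absurd hzη (by rcases zmod2_eq_zero_or_one η.2 with h | h <;> rw [h] <;> decide)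
    -- both θ and η see v: their sum kills v and is violated at z
    have hsum := viol (θ + η) (Submodule.add_mem _ hθ hη)
      (by rw [Prod.fst_add, add_dotProduct, hθv, hηv]; decide)
    rw [Prod.fst_add, Prod.snd_add, add_dotProduct, hzθ] at hsum
    rw [dotProduct_add, hηv] at hzη
    -- hzη : η.1 ⬝ᵥ z + 1 = η.2 + 1, hsum : θ.2 + 1 + η.1 ⬝ᵥ z = θ.2 + η.2
    have hηz : η.1 ⬝ᵥ z = η.2 := by
      rcases zmod2_eq_zero_or_one (η.1 ⬝ᵥ z) with h | h <;>
        rcases zmod2_eq_zero_or_one η.2 with h' | h' <;> rw [h, h'] at hzη ⊢ <;>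
        first | rfl | exact absurd hzη (by decide)
    rw [hηz] at hsum
    rcases zmod2_eq_zero_or_one θ.2 with h | h <;>
      rcases zmod2_eq_zero_or_one η.2 with h' | h' <;> rw [h, h'] at hsum <;>
      exact absurd hsum (by decide)
  · rw [Set.not_nonempty_iff_eq_empty] at hne
    subst hne
    have : cyl v (∅ : Set (V → ZMod 2)) = ∅ := by simp [cyl]
    rw [this]
    exact isFlat_empty

/-- A PROPER cylinder (direction seen by some equation of `S`) lowers `dim W` by exactly one. -/
theorem finrank_W_cyl_add_one (v : V → ZMod 2) {S : Set (V → ZMod 2)} (hne : S.Nonempty)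
    {θ₀ : Eqn V} (hθ₀ : θ₀ ∈ W S) (hv : θ₀.1 ⬝ᵥ v = 1) :
    finrank (ZMod 2) ↥(W (cyl v S)) + 1 = finrank (ZMod 2) ↥(W S) := by
  classical
  -- restrict `evalAt v` to `W S`; it is onto `𝔽₂`, with kernel `W (cyl v S)`
  set f : ↥(W S) →ₗ[ZMod 2] ZMod 2 := (evalAt v).domRestrict (W S) with hf
  have hrn := LinearMap.finrank_range_add_finrank_ker f
  have hrange : LinearMap.range f = ⊤ := by
    rw [eq_top_iff]
    intro c _
    refine ⟨c • ⟨θ₀, hθ₀⟩, ?_⟩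
    simp [hf, hv]
  have hr1 : finrank (ZMod 2) ↥(LinearMap.range f) = 1 := by
    rw [hrange, finrank_top, Module.finrank_self]
  have hker : finrank (ZMod 2) ↥(LinearMap.ker f) = finrank (ZMod 2) ↥(W (cyl v S)) := by
    rw [W_cyl v hne]
    -- `ker f` ≅ `W S ⊓ ker (evalAt v)` via the subtype embedding
    have hmap : Submodule.map (W S).subtype (LinearMap.ker f) = W S ⊓ LinearMap.ker (evalAt v) := by
      ext η
      simp only [Submodule.mem_map, LinearMap.mem_ker, Submodule.mem_inf, hf,
        LinearMap.domRestrict_apply, Submodule.subtype_apply]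
      constructor
      · rintro ⟨⟨η', hη'⟩, hk, rfl⟩
        exact ⟨hη', hk⟩
      · rintro ⟨hη, hk⟩
        exact ⟨⟨η, hη⟩, hk, rfl⟩
    rw [← hmap]
    exact (LinearEquiv.finrank_eq (Submodule.equivMapOfInjective _ (Submodule.injective_subtype _)
      _)).symm.trans rfl |>.symm
  omega

-- END BODY
end ResLinSW

end Summit.PneNP.PneNP.Theorems
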